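import Mathlib.Analysis.SpecialFunctions.Elliptic.Weierstrass
import Literature.NumberTheory.EllipticCurves.WeierstrassZeta
import Literature.NumberTheory.EllipticCurves.WeierstrassSigma
import HarnessLib

/-!
# Addition theorems for the Weierstrass functions `℘`, `ζ`, `σ`

Topic `Literature/NumberTheory/EllipticCurves`; dot-notation extensions of Mathlib's
`PeriodPair` (as in `WeierstrassZeta.lean`, `WeierstrassSigma.lean`). Named facts (D-0014) for
the three classical addition formulae of the Weierstrass theory of a period lattice
`Λ = ℤω₁ + ℤω₂`, with `℘ = ℘[L]`, `℘' = ℘'[L]` (Mathlib), `ζ = L.weierstrassZeta`,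
`σ = L.weierstrassSigma` (tree):

* `weierstrassP_sub_eq_sigma` — `℘(u) - ℘(v) = -σ(u-v)σ(u+v) / (σ(u)²σ(v)²)`
  (Armitage–Eberlein, §7.4.1, eq. (7.63); Huber–Wüstholz 2022, §18.3, the identity
  `σ(v+u)σ(v-u)/(σ(v)²σ(u)²) = -℘(v) + ℘(u)` "(14) in [Fri11, p. 217]");
* `weierstrassZeta_add` — `ζ(u+v) = ζ(u) + ζ(v) + ½ (℘'(u) - ℘'(v))/(℘(u) - ℘(v))`
  (Armitage–Eberlein, §7.4.2, eq. (7.66); Huber–Wüstholz 2022, §18.1: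
  `d log F(z; u) = (ζ(z-u) - ζ(z) + ζ(u)) dz = ½ (℘'(z) + ℘'(u))/(℘(z) - ℘(u)) dz`, and §18.2:
  `-ζ(w+v) + ζ(v) = -ζ(w) - ½ (℘'(w) - ℘'(v))/(℘(w) - ℘(v))`);
* `weierstrassP_add` — `℘(u+v) = ¼ ((℘'(u) - ℘'(v))/(℘(u) - ℘(v)))² - ℘(u) - ℘(v)`
  (Armitage–Eberlein, §7.4.2, Theorem "addition theorem for `℘`", eq. (7.68)), and its
  degenerate case `weierstrassP_two_mul` — `℘(2u) = ¼ (℘''(u)/℘'(u))² - 2℘(u)`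
  (loc. cit., Corollary following (7.68)).

Why here: these formulae are the algebraic group law of the elliptic curve
`E : y² = 4x³ - g₂x - g₃` uniformised by `(℘, ℘')` and — through `t - ζ(z)` — of its universal
vectorial extension `E♮` (exponential `(z, t) ↦ (℘(z), ℘′(z), t - ζ(z))`, Baker–Wüstholz 2007,
proof of Thm. 6.3); see `PeriodPair.univExtCoord_add` below and
`Transcendental/AnalyticSubgroupElliptic.lean` (decomposition of
`Literature.NumberTheory.Transcendental.HuberWustholzOnePeriods`, whose transcendence input lives on `𝔾ₐ × 𝔾ₘ² × (E♮)²`).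
They are leaves of that DAG: every transcendence proof about `ω, η, ℘(u), ζ(u)` evaluates
auxiliary polynomials in `℘, ℘′, ζ` at multiples/sums of points via exactly these identities.

Hypotheses. Mathlib's `℘, ℘'` and the tree's `ζ, σ` are total functions with junk values on
`Λ`; the facts therefore assume `u, v ∉ Λ`, and the non-degeneracy `℘(u) ≠ ℘(v)` (which, as
`℘` is even and `Λ`-periodic, already forces `u ± v ∉ Λ`; classically it is equivalent to
`u ≢ ±v (mod Λ)`), resp. `℘'(u) ≠ 0` (which forces `2u ∉ Λ`) — exactly the conditions under
which the printed formulae are meaningful. Nothing is asserted: users take `(h : L.weierstrassP_add)`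
etc. Proved here: the symmetric/odd companions and the consequences
`weierstrassZeta_add_add_sub` (Armitage–Eberlein (7.64)) and `univExtCoord_add` (rationality
of the group law of `E♮` in the coordinates `(℘, ℘′, t - ζ)`).

Discharge plan (not attempted here; recorded for the owner of the facts): (7.63) by Liouville —
`z ↦ ℘(z) - ℘(v) + σ(z-v)σ(z+v)/(σ(z)²σ(v)²)` is `Λ`-periodic (quasi-periodicity of `σ`,
`WeierstrassSigma.lean`) and entire (the double poles at `Λ` cancel: `σ(z) = z + O(z⁵)`,
`σ(z-v)σ(z+v) = -σ(v)² + (σ′² - σσ″)(v) z² + O(z⁴)`), hence constant, `= 0` at `z = v`; then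
(7.66) by logarithmic differentiation in `u` (`σ′/σ = ζ`) and symmetrisation, and (7.68) by
differentiating (7.66) (`ζ′ = -℘`, `℘″ = 6℘² - g₂/2` from Mathlib's `derivWeierstrassP_sq`).

## References

* J. V. Armitage, W. F. Eberlein, *Elliptic Functions*, LMS Student Texts 67, CUP: §7.4.1
  (eq. (7.63)), §7.4.2 (eqs. (7.64)–(7.68), the addition theorem for `℘` and its corollary
  for `℘(2u)`).
* A. Huber, G. Wüstholz, *Transcendence and Linear Relations of 1-Periods*, Cambridge Tracts
  227, CUP 2022: §18.1 (`exp_E^* ξ_P`), §18.2 (incomplete periods of the second kind), §18.3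
  (the `σ`-identity (14) of [Fri11]).
* A. Baker, G. Wüstholz, *Logarithmic Forms and Diophantine Geometry*, CUP 2007, proof of
  Thm. 6.3 (exponential of the `𝔾ₐ`-extension: `z₋₁ + M″(ζ(z₁), …, ζ(zₙ))`, `℘(z_j)`, `℘′(z_j)`).
-/

noncomputable section

open Complex

namespace PeriodPair

variable (L : PeriodPair)

/-! ### The three named facts -/

/-- NAMED FACT — **`σ`-product formula for `℘(u) - ℘(v)`**: for `u, v ∉ Λ`,
`℘(u) - ℘(v) = -σ(u - v) σ(u + v) / (σ(u)² σ(v)²)`. Users take `(h : L.weierstrassP_sub_eq_sigma)`.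
[cite: ArmitageEberlein2001, §7.4.1 eq. (7.63)] [cite: HuberWustholz2022, §18.3 (identity (14) of [Fri11, p. 217]: σ(v+u)σ(v−u)/(σ(v)²σ(u)²) = −℘(v)+℘(u))] -/
def weierstrassP_sub_eq_sigma : Prop :=
  ∀ u v : ℂ, u ∉ L.lattice → v ∉ L.lattice →
    ℘[L] u - ℘[L] v =
      -(L.weierstrassSigma (u - v) * L.weierstrassSigma (u + v)) /
        (L.weierstrassSigma u ^ 2 * L.weierstrassSigma v ^ 2)

/-- NAMED FACT — **addition (pseudo-addition) theorem for `ζ`**: for `u, v ∉ Λ` with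
`℘(u) ≠ ℘(v)` (i.e. `u ≢ ±v (mod Λ)`),
`ζ(u + v) = ζ(u) + ζ(v) + ½ · (℘′(u) - ℘′(v)) / (℘(u) - ℘(v))`. Users take
`(h : L.weierstrassZeta_add)`.
[cite: ArmitageEberlein2001, §7.4.2 eq. (7.66)] [cite: HuberWustholz2022, §18.1–18.2 (d log F(z;u) = (ζ(z−u) − ζ(z) + ζ(u))dz = ½(℘′(z)+℘′(u))/(℘(z)−℘(u)) dz; η(γ) = −ζ(w+v) + ζ(v) = −ζ(w) − ½(℘′(w)−℘′(v))/(℘(w)−℘(v)))] -/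
def weierstrassZeta_add : Prop :=
  ∀ u v : ℂ, u ∉ L.lattice → v ∉ L.lattice → ℘[L] u ≠ ℘[L] v →
    L.weierstrassZeta (u + v) =
      L.weierstrassZeta u + L.weierstrassZeta v + (℘'[L] u - ℘'[L] v) / (℘[L] u - ℘[L] v) / 2

/-- NAMED FACT — **addition theorem for `℘`**: for `u, v ∉ Λ` with `℘(u) ≠ ℘(v)`,
`℘(u + v) = ¼ · ((℘′(u) - ℘′(v)) / (℘(u) - ℘(v)))² - ℘(u) - ℘(v)`. Users take
`(h : L.weierstrassP_add)`.
[cite: ArmitageEberlein2001, §7.4.2, Theorem (addition theorem for ℘), eq. (7.68)] -/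
def weierstrassP_add : Prop :=
  ∀ u v : ℂ, u ∉ L.lattice → v ∉ L.lattice → ℘[L] u ≠ ℘[L] v →
    ℘[L] (u + v) = ((℘'[L] u - ℘'[L] v) / (℘[L] u - ℘[L] v)) ^ 2 / 4 - ℘[L] u - ℘[L] v

/-- NAMED FACT — **duplication formula for `℘`** (the case `v → u` of the addition theorem):
for `u ∉ Λ` with `℘′(u) ≠ 0` (i.e. `2u ∉ Λ`), `℘(2u) = ¼ · (℘″(u) / ℘′(u))² - 2℘(u)`, where
`℘″ = (℘′)′`. Users take `(h : L.weierstrassP_two_mul)`.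
[cite: ArmitageEberlein2001, §7.4.2, Corollary to the addition theorem (℘(2u) = ¼{℘″(u)/℘′(u)}² − 2℘(u))] -/
def weierstrassP_two_mul : Prop :=
  ∀ u : ℂ, u ∉ L.lattice → ℘'[L] u ≠ 0 →
    ℘[L] (2 * u) = (deriv ℘'[L] u / ℘'[L] u) ^ 2 / 4 - 2 * ℘[L] u

variable {L}

/-! ### Elementary API (proved) -/

/-- Non-degeneracy `℘(u) ≠ ℘(v)` forces `u + v ∉ Λ` (`℘` is even and `Λ`-periodic). [folklore] -/
theorem add_notMem_lattice_of_weierstrassP_ne {u v : ℂ} (h : ℘[L] u ≠ ℘[L] v) :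
    u + v ∉ L.lattice := by
  intro hmem
  apply h
  have : v = -u + (u + v) := by ring
  rw [this, ← Subtype.coe_mk (u + v) hmem, L.weierstrassP_add_coe, L.weierstrassP_neg]

/-- Non-degeneracy `℘(u) ≠ ℘(v)` forces `u - v ∉ Λ`. [folklore] -/
theorem sub_notMem_lattice_of_weierstrassP_ne {u v : ℂ} (h : ℘[L] u ≠ ℘[L] v) :
    u - v ∉ L.lattice := by
  intro hmem
  apply h
  have : u = v + (u - v) := by ring
  rw [this, ← Subtype.coe_mk (u - v) hmem, L.weierstrassP_add_coe]

/-- `℘′(u) ≠ 0` forces `2u ∉ Λ` (`℘′` is odd and `Λ`-periodic). [folklore] -/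
theorem two_mul_notMem_lattice_of_derivWeierstrassP_ne_zero {u : ℂ} (h : ℘'[L] u ≠ 0) :
    2 * u ∉ L.lattice := by
  intro hmem
  apply h
  have key : ℘'[L] u = -℘'[L] u := by
    have : u = -u + 2 * u := by ring
    conv_lhs => rw [this, ← Subtype.coe_mk (2 * u) hmem, L.derivWeierstrassP_add_coe,
      L.derivWeierstrassP_neg]
  have h2 : (2 : ℂ) * ℘'[L] u = 0 := by linear_combination key
  simpa using h2

/-- The addition theorem for `℘` is symmetric in `u, v` (as it must be). [folklore] -/
theorem weierstrassP_add_symm (u v : ℂ) :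
    ((℘'[L] u - ℘'[L] v) / (℘[L] u - ℘[L] v)) ^ 2 / 4 - ℘[L] u - ℘[L] v =
      ((℘'[L] v - ℘'[L] u) / (℘[L] v - ℘[L] u)) ^ 2 / 4 - ℘[L] v - ℘[L] u := by
  have hq : (℘'[L] v - ℘'[L] u) / (℘[L] v - ℘[L] u) =
      (℘'[L] u - ℘'[L] v) / (℘[L] u - ℘[L] v) := by
    rw [← neg_sub (℘'[L] u), ← neg_sub (℘[L] u), neg_div_neg_eq]
  rw [hq]
  ring

/-- **Subtraction form of the `ζ` addition theorem**: for `u, v ∉ Λ`, `℘(u) ≠ ℘(v)`,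
`ζ(u - v) = ζ(u) - ζ(v) + ½ (℘′(u) + ℘′(v))/(℘(u) - ℘(v))` (replace `v` by `-v`; `ζ, ℘′` odd,
`℘` even). This is Huber–Wüstholz's `ζ(z-u) - ζ(z) + ζ(u) = ½ (℘′(z)+℘′(u))/(℘(z)-℘(u))`.
[cite: HuberWustholz2022, §18.1] -/
theorem weierstrassZeta_sub (h : L.weierstrassZeta_add) {u v : ℂ} (hu : u ∉ L.lattice)
    (hv : v ∉ L.lattice) (hne : ℘[L] u ≠ ℘[L] v) :
    L.weierstrassZeta (u - v) =
      L.weierstrassZeta u - L.weierstrassZeta v +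
        (℘'[L] u + ℘'[L] v) / (℘[L] u - ℘[L] v) / 2 := by
  have hv' : -v ∉ L.lattice := fun hm => hv (by simpa using L.lattice.neg_mem hm)
  have hne' : ℘[L] u ≠ ℘[L] (-v) := by rwa [L.weierstrassP_neg]
  have := h u (-v) hu hv' hne'
  rw [L.weierstrassP_neg, L.derivWeierstrassP_neg, L.weierstrassZeta_neg] at this
  rw [sub_eq_add_neg u v, this]
  ring

/-- **(7.64) of Armitage–Eberlein**: `ζ(u + v) + ζ(u - v) - 2ζ(u) = ℘′(u)/(℘(u) - ℘(v))`, the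
logarithmic `u`-derivative of the `σ`-product formula; here derived from the `ζ` addition
theorem and its subtraction form. [cite: ArmitageEberlein2001, §7.4.2 eq. (7.64)] -/
theorem weierstrassZeta_add_add_sub (h : L.weierstrassZeta_add) {u v : ℂ} (hu : u ∉ L.lattice)
    (hv : v ∉ L.lattice) (hne : ℘[L] u ≠ ℘[L] v) :
    L.weierstrassZeta (u + v) + L.weierstrassZeta (u - v) - 2 * L.weierstrassZeta u =
      ℘'[L] u / (℘[L] u - ℘[L] v) := by
  rw [h u v hu hv hne, weierstrassZeta_sub h hu hv hne]
  have hd : ℘[L] u - ℘[L] v ≠ 0 := sub_ne_zero.mpr hne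
  field_simp
  ring

/-- **The group law of `E♮` is rational in the coordinates `(℘, ℘′, t - ζ)`.** Writing
`f(z, t) = t - ζ(z)` for the third component of the exponential of the universal vectorial
extension (Baker–Wüstholz 2007, proof of Thm. 6.3), the `ζ` addition theorem gives
`f(z₁ + z₂, t₁ + t₂) = f(z₁, t₁) + f(z₂, t₂) - ½ (℘′(z₁) - ℘′(z₂))/(℘(z₁) - ℘(z₂))`, a rational
function over `ℚ` of the coordinates of the two summands.
[cite: BakerWustholz2007, proof of Thm. 6.3] -/
theorem univExtCoord_add (h : L.weierstrassZeta_add) {z₁ z₂ : ℂ} (t₁ t₂ : ℂ)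
    (h₁ : z₁ ∉ L.lattice) (h₂ : z₂ ∉ L.lattice) (hne : ℘[L] z₁ ≠ ℘[L] z₂) :
    (t₁ + t₂) - L.weierstrassZeta (z₁ + z₂) =
      (t₁ - L.weierstrassZeta z₁) + (t₂ - L.weierstrassZeta z₂) -
        (℘'[L] z₁ - ℘'[L] z₂) / (℘[L] z₁ - ℘[L] z₂) / 2 := by
  rw [h z₁ z₂ h₁ h₂ hne]
  ring

end PeriodPair

end
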